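import Mathlib
import HarnessLib
import Summits.ResolutionOfSingularities.ResolutionOfSingularities.Theorems.WildQuotientsWildQuotientResolutionKSGoingDownLocalPackage
import Summits.ResolutionOfSingularities.ResolutionOfSingularities.Theorems.WildQuotientsWildQuotientResolutionKSGoingDownLocalGlue
import Summits.ResolutionOfSingularities.ResolutionOfSingularities.Theorems.WildQuotientsWildQuotientResolutionKSGoingDownSpecHomAction
import Summits.ResolutionOfSingularities.ResolutionOfSingularities.Theorems.WildQuotientsWildQuotientResolutionKSGoingDownQuadraticTransformRegular
import Summits.ResolutionOfSingularities.ResolutionOfSingularities.Theorems.WildQuotientsWildQuotientResolutionKSGoingDownQuadraticTransformQuotient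

/-!
# Kollár–Szabó going down: the `η / E / x₁` package of the local blow-up step for the quadratic transform
# `R₁ = S[𝔪/t]_𝔫` with a residue-trivial action (crux `WildQuotients.WildQuotientResolution`, stub `stub_phaseZeroHighDim`)

Crux stmt-ResolutionOfSingularities-15640 (`WildQuotientResolution`), registered stub `stub_phaseZeroHighDim`; programme:
`KollarSzaboGoingDown_holds` via ✓`kollarSzaboGoingDown_of_localStepLE`. For `R₁ = LocalSubring.ofPrime (blowupRing S t) 𝔫`
(`S ⊆ K` regular local, `t ∈ 𝔪 ∖ 𝔪²`, `𝔫 ∋ t` prime — the shape of hand 8-g1's equivariant quadratic transform, via the tree's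
✓`IsQuadraticTransform.eq_ofPrime`) carrying an action `τ₁ : G →* (R₁ ≃+* R₁)` which is RESIDUE-TRIVIAL and stabilises `(t)`,
with `κ(R₁)` algebraically closed, this file produces ALL conclusion clauses of the local step that live on `Spec R₁`:

* `localStep_package_ofPrime` — `ρ₁ : G →* Aut (Spec R₁)` (`ρ₁ g = Spec (τ₁ g⁻¹)`), the point `η = (t)` with VALUATION-RING local
  ring, `E = Spec (R₁/(t))` INTEGRAL with the induced action `σE` and the equivariant closed immersion `i : E → Spec R₁` hitting
  `η`, and the closed point `x₁ ∈ E` with `𝒪_{E,x₁}` REGULAR, `κ` ALGEBRAICALLY CLOSED, `G ≤ I_{x₁}`, `dim 𝒪_{E,x₁} ≤ #{j ≠ 0} = dim S − 1`.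

What then remains for `localStepLE` (memo KS-GOINGDOWN-ASSEMBLY.md): realise `𝒪_{X,x}` as `S ⊆ K := Frac 𝒪_{X,x}` with the stalk
action extended to `K` (input of ✓`EigenlineChart.exists_equivariant_quadraticTransform`), check `(t)R₁`-stability
(`𝔪_S R₁ = t R₁`), and the dominant equivariant `b : Spec R₁ → Spec 𝒪_{X,x} → X`.

[OURS · crux stmt-ResolutionOfSingularities-15640 · helper toward `stub_phaseZeroHighDim` (packaging; NOT a proof of the stub); counted 0;
AI-level work, weaker than expert review.] [folklore]
-/

-- single-problem summit: the doubled namespace component `ResolutionOfSingularities` is forced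
set_option linter.dupNamespace false

noncomputable section

open CategoryTheory AlgebraicGeometry IsLocalRing
open Literature.AlgebraicGeometry.Ramification Literature.AlgebraicGeometry.Resolution

namespace Summit.ResolutionOfSingularities.ResolutionOfSingularities.Theorems.WildQuotientResolution.KSGoingDown

universe u

/-- For a local ring `R` and an ideal `I` with `R/I` local, `R → R/I` is a local homomorphism. [folklore] -/
theorem isLocalHom_quotient_mk {R : Type u} [CommRing R] [IsLocalRing R] (I : Ideal R) [IsLocalRing (R ⧸ I)] :
    IsLocalHom (Ideal.Quotient.mk I) :=
  IsLocalHom.of_surjective _ Ideal.Quotient.mk_surjective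

set_option maxHeartbeats 800000 in
/-- ★ **The `η / E / x₁` package of the local blow-up step on `Spec R₁`**, `R₁ = (LocalSubring.ofPrime (blowupRing S t) 𝔫).toSubring = S[𝔪/t]_𝔫 ⊆ K` — see the module docstring.
[folklore; after ReichsteinYoussin2000, Appendix, proof of Prop. A.2] -/
theorem localStep_package_ofPrime {K : Type u} [Field K] (S : Subring K) [IsRegularLocalRing S] {d : ℕ}
    (hd : (maximalIdeal S).spanFinrank = d) (hd0 : 0 < d) {t : K} (htS : t ∈ S)
    (htm : (⟨t, htS⟩ : S) ∈ maximalIdeal S) (ht2 : (⟨t, htS⟩ : S) ∉ maximalIdeal S ^ 2) (ht0 : t ≠ 0)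
    (𝔫 : Ideal (blowupRing S t)) [𝔫.IsPrime] (ht𝔫 : (⟨t, le_blowupRing S t htS⟩ : blowupRing S t) ∈ 𝔫)
    [IsAlgClosed (ResidueField (LocalSubring.ofPrime (blowupRing S t) 𝔫).toSubring)]
    {G : Type u} [Group G]
    (τ₁ : G →* ((LocalSubring.ofPrime (blowupRing S t) 𝔫).toSubring ≃+* (LocalSubring.ofPrime (blowupRing S t) 𝔫).toSubring))
    (hres : ∀ (g : G) (r : (LocalSubring.ofPrime (blowupRing S t) 𝔫).toSubring),
      τ₁ g r - r ∈ maximalIdeal (LocalSubring.ofPrime (blowupRing S t) 𝔫).toSubring)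
    (hstab : ∀ (g : G), ∀ r ∈ Ideal.span {(⟨t, LocalSubring.le_ofPrime _ _ (le_blowupRing S t htS)⟩ :
        (LocalSubring.ofPrime (blowupRing S t) 𝔫).toSubring)},
      τ₁ g r ∈ Ideal.span {(⟨t, LocalSubring.le_ofPrime _ _ (le_blowupRing S t htS)⟩ :
        (LocalSubring.ofPrime (blowupRing S t) 𝔫).toSubring)}) :
    ∃ (ρ₁ : G →* Aut (Spec (CommRingCat.of (LocalSubring.ofPrime (blowupRing S t) 𝔫).toSubring)))
      (_ : ∀ g, (ρ₁ g).hom = Spec.map (CommRingCat.ofHom ((τ₁ g⁻¹ :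
        (LocalSubring.ofPrime (blowupRing S t) 𝔫).toSubring ≃+* (LocalSubring.ofPrime (blowupRing S t) 𝔫).toSubring) :
        (LocalSubring.ofPrime (blowupRing S t) 𝔫).toSubring →+* (LocalSubring.ofPrime (blowupRing S t) 𝔫).toSubring)))
      (η : Spec (CommRingCat.of (LocalSubring.ofPrime (blowupRing S t) 𝔫).toSubring))
      (_ : ValuationRing ((Spec (CommRingCat.of (LocalSubring.ofPrime (blowupRing S t) 𝔫).toSubring)).presheaf.stalk η))
      (E : Scheme.{u}) (_ : IsIntegral E) (σE : G →* Aut E)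
      (i : E ⟶ Spec (CommRingCat.of (LocalSubring.ofPrime (blowupRing S t) 𝔫).toSubring))
      (_ : ∀ g, (σE g).hom ≫ i = i ≫ (ρ₁ g).hom) (_ : η ∈ Set.range i.base) (x₁ : E),
      IsRegularLocalRing (E.presheaf.stalk x₁) ∧ IsAlgClosed (ResidueField (E.presheaf.stalk x₁)) ∧
      (∀ g, g ∈ inertiaSubgroup σE x₁) ∧ ringKrullDim (E.presheaf.stalk x₁) ≤ Nat.card {j : Fin d // j ≠ ⟨0, hd0⟩} := by
  -- notation: `R₁ := (LocalSubring.ofPrime (blowupRing S t) 𝔫).toSubring = S[𝔪/t]_𝔫`, `tR = t ∈ R₁`, `I' = (t)R₁`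
  let tR : (LocalSubring.ofPrime (blowupRing S t) 𝔫).toSubring := ⟨t, LocalSubring.le_ofPrime _ _ (le_blowupRing S t htS)⟩
  let I' : Ideal (LocalSubring.ofPrime (blowupRing S t) 𝔫).toSubring := Ideal.span {tR}
  -- `R₁` is a regular local ring; `R₁/(t)` is regular local of dimension `≤ #{j ≠ 0}`
  obtain ⟨z, hz, hzj⟩ := exists_rsop_apply_eq hd htm ht2 ⟨0, hd0⟩
  have hzt : ((z ⟨0, hd0⟩ : S) : K) = t := by rw [hzj]
  haveI hR1reg : IsRegularLocalRing (LocalSubring.ofPrime (blowupRing S t) 𝔫).toSubring := by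
    have h := isRegularLocalRing_ofPrime_blowupRing S hd z hz ⟨0, hd0⟩
    rw [hzt] at h
    exact h 𝔫
  haveI : IsDomain (LocalSubring.ofPrime (blowupRing S t) 𝔫).toSubring := inferInstance
  have hmap : (Ideal.span {(⟨t, le_blowupRing S t htS⟩ : blowupRing S t)}).map (algebraMap (blowupRing S t) (LocalSubring.ofPrime (blowupRing S t) 𝔫).toSubring) = I' := by
    rw [Ideal.map_span, Set.image_singleton]
    rfl
  haveI hQreg : IsRegularLocalRing ((LocalSubring.ofPrime (blowupRing S t) 𝔫).toSubring ⧸ I') := by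
    have h := isRegularLocalRing_ofPrime_blowupRing_quotient S htS htm ht2 ht0 𝔫 ht𝔫
    rw [hmap] at h
    exact h
  have hQdim : ringKrullDim ((LocalSubring.ofPrime (blowupRing S t) 𝔫).toSubring ⧸ I') ≤ Nat.card {j : Fin d // j ≠ ⟨0, hd0⟩} := by
    have h := ringKrullDim_ofPrime_blowupRing_quotient_le S htS 𝔫 ht𝔫
    rw [hmap, ringKrullDim_blowupRing_quotient S htS htm ht2 ht0 hd hd0] at h
    exact h
  haveI : IsDomain ((LocalSubring.ofPrime (blowupRing S t) 𝔫).toSubring ⧸ I') := isDomain_of_isRegularLocalRing _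
  haveI hI'prime : I'.IsPrime := (Ideal.Quotient.isDomain_iff_prime _).mp inferInstance
  -- `t` in `(LocalSubring.ofPrime (blowupRing S t) 𝔫).toSubring`: a non-zero non-unit
  have htRm : tR ∈ maximalIdeal (LocalSubring.ofPrime (blowupRing S t) 𝔫).toSubring :=
    (IsLocalization.AtPrime.to_map_mem_maximal_iff (LocalSubring.ofPrime (blowupRing S t) 𝔫).toSubring 𝔫 (⟨t, le_blowupRing S t htS⟩ : blowupRing S t)).mpr ht𝔫
  have htR0 : tR ≠ 0 := fun h => ht0 (congrArg Subtype.val h)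
  -- the actions on `Spec (LocalSubring.ofPrime (blowupRing S t) 𝔫).toSubring`, on `(LocalSubring.ofPrime (blowupRing S t) 𝔫).toSubring/(t)` and on `E = Spec ((LocalSubring.ofPrime (blowupRing S t) 𝔫).toSubring/(t))`
  obtain ⟨ρ₁, hρ₁⟩ := exists_specAction_of_hom τ₁
  obtain ⟨τq, hτq⟩ := exists_quotient_ringAut τ₁ I' hstab
  obtain ⟨σE, hσE⟩ := exists_specAction_of_hom τq
  -- the residue field of `(LocalSubring.ofPrime (blowupRing S t) 𝔫).toSubring/(t)` and residue-triviality of the quotient action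
  haveI : IsLocalHom (Ideal.Quotient.mk I') := isLocalHom_quotient_mk I'
  haveI : IsAlgClosed (ResidueField ((LocalSubring.ofPrime (blowupRing S t) 𝔫).toSubring ⧸ I')) :=
    isAlgClosed_residueField_of_residue_surjective (Ideal.Quotient.mk I') fun q => by
      obtain ⟨r, rfl⟩ := Ideal.Quotient.mk_surjective q
      exact ⟨r, by rw [sub_self]; exact Ideal.zero_mem _⟩
  have hresq : ∀ (g : G) (q : (LocalSubring.ofPrime (blowupRing S t) 𝔫).toSubring ⧸ I'), τq g q - q ∈ maximalIdeal ((LocalSubring.ofPrime (blowupRing S t) 𝔫).toSubring ⧸ I') := by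
    intro g q
    obtain ⟨r, rfl⟩ := Ideal.Quotient.mk_surjective q
    rw [hτq, ← map_sub]
    exact map_nonunit (Ideal.Quotient.mk I') _ (hres g r)
  -- the point `η = (t)` and its valuation ring
  let η : Spec (CommRingCat.of (LocalSubring.ofPrime (blowupRing S t) 𝔫).toSubring) := (⟨I', hI'prime⟩ : PrimeSpectrum (LocalSubring.ofPrime (blowupRing S t) 𝔫).toSubring)
  haveI : ValuationRing (Localization.AtPrime η.asIdeal) :=
    valuationRing_localization_of_isPrime_span_singleton (S := (LocalSubring.ofPrime (blowupRing S t) 𝔫).toSubring) htRm htR0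
  have hη : ValuationRing ((Spec (CommRingCat.of (LocalSubring.ofPrime (blowupRing S t) 𝔫).toSubring)).presheaf.stalk η) := valuationRing_stalk_spec η
  -- `E`, `i`, `x₁`
  refine ⟨ρ₁, hρ₁, η, hη, Spec (CommRingCat.of ((LocalSubring.ofPrime (blowupRing S t) 𝔫).toSubring ⧸ I')), inferInstance, σE,
    Spec.map (CommRingCat.ofHom (Ideal.Quotient.mk I')), fun g => ?_, ?_, closedPoint ((LocalSubring.ofPrime (blowupRing S t) 𝔫).toSubring ⧸ I'),
    isRegularLocalRing_stalk_closedPoint, isAlgClosed_residueField_stalk_closedPoint,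
    fun g => mem_inertiaSubgroup_closedPoint_of_hom_residueTrivial τq σE hσE g (hresq g), ?_⟩
  · -- equivariance of `i`
    exact specMap_comm_of_hom_equivariant τ₁ τq ρ₁ hρ₁ σE hσE (Ideal.Quotient.mk I') (fun g r => (hτq g r).symm) g
  · -- `η` is the image of the generic point of `E`
    refine ⟨(⟨⊥, Ideal.isPrime_bot⟩ : PrimeSpectrum ((LocalSubring.ofPrime (blowupRing S t) 𝔫).toSubring ⧸ I')), ?_⟩
    apply PrimeSpectrum.ext
    change Ideal.comap (Ideal.Quotient.mk I') ⊥ = I'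
    rw [← RingHom.ker_eq_comap_bot, Ideal.mk_ker]
  · -- dimension at the closed point
    rw [ringKrullDim_stalk_closedPoint]
    exact hQdim

end Summit.ResolutionOfSingularities.ResolutionOfSingularities.Theorems.WildQuotientResolution.KSGoingDown

end
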